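import Summits.Ventures.PercRepro.S2QuartMultiplicity

/-!
# PercRepro — S2: THE QUARTIC MULTIPLICITY, THE PAIRS AND THE LEVEL COUNTS (p4, gen 17; p7's S2SquareMultiplicity3B with
the quartic multiplicity `card_spanF_ge_quart` of S2QuartMultiplicity in place of `card_spanF_ge_three`)

For a rank-`q` set `B` of `m > q` elements the level-`m` fibre holds `≥ (m − q) + 3·C(m − q, 2) + 3·C(m − q, 3) + 2·C(m − q, 4)` pairs
(`card_pairs_ge_quart`: every spanning `(q+1)`-subset is the union of exactly one pair), so the level double count reads
`((m − q) + 3·C(m − q, 2) + 3·C(m − q, 3) + 2·C(m − q, 4))·#levelF ≤ Σ_p #fibreLevel` (`mul_card_levelF_le_sum_quart`) and, with the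
giant split, `mul_card_levelF_le_giant_quart`. Proofs byte for byte p7's, the multiplicity expression changed. Axioms: standard.
-/

open scoped Matroid

namespace PercRepro

namespace S2

open Set Finset

variable {α : Type} {M : Matroid α}

open scoped Classical in
/-- **The sharpened multiplicity of the pairs**: a rank-`q` set `B` of `m > q` elements lies in the level-`m` fibre of
at least `(m − q) + 3·C(m − q, 2)` pairs — every spanning `(q+1)`-subset `D` of `B` is the union `C ∪ B′` of exactly one pair (its
circuit, by night-1's `exists_circuit_extension_exact`), and `B` lies in that pair's fibre. -/
theorem card_pairs_ge_quart [M.Finite] (q : ℕ) (hq : 1 ≤ q) (hcirc : ∀ C, M.IsCircuit C → 3 ≤ C.encard)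
    (hC1 : ∀ L ⊆ M.E, M.eRk L = 2 → L.ncard ≤ 3)
    (hC2 : ∀ L ⊆ M.E, M.eRk L ≤ 3 → L.ncard ≤ 6)
    {B : Finset α} (hBE : (B : Set α) ⊆ M.E) (hBq : M.eRk (B : Set α) = (q : ℕ∞)) :
    (B.card - q) + 3 * (B.card - q).choose 2 + 3 * (B.card - q).choose 3 + 2 * (B.card - q).choose 4 ≤ ((Matroid.pairsF M q).filter (fun p => p.1 ∪ p.2 ⊆ (B : Set α) ∧
      (B : Set α) ⊆ M.closure (p.1 ∪ p.2))).card := by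
  classical
  refine (card_spanF_ge_quart q hq hcirc hC1 hC2 hBE hBq).trans ?_
  apply Finset.card_le_card_of_surjOn (fun p : Set α × Set α => p.1 ∪ p.2)
  intro D hD
  rw [Finset.mem_coe, mem_spanF] at hD
  obtain ⟨D', hD'B, hD'card, hD'q, hBcl, rfl⟩ := hD
  have hD'E : (D' : Set α) ⊆ M.E := (Finset.coe_subset.2 hD'B).trans hBE
  have hD'ncard : (D' : Set α).ncard = q + 1 := by rw [Set.ncard_coe_finset]; exact hD'card
  obtain ⟨C, B', hC, hCD, hB'D, hdisj, hcard, hDcl⟩ :=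
    Matroid.exists_circuit_extension_exact hD'E hD'q (by rw [hD'ncard]; omega)
  have hCfin : C.Finite := D'.finite_toSet.subset hCD
  have hB'fin : B'.Finite := D'.finite_toSet.subset hB'D
  have hunion_sub : C ∪ B' ⊆ (D' : Set α) := Set.union_subset hCD hB'D
  have hunion_card : (C ∪ B').ncard = q + 1 := by
    rw [Set.ncard_union_eq hdisj.symm hCfin hB'fin]; exact hcard
  have hunion : C ∪ B' = (D' : Set α) :=
    Set.eq_of_subset_of_ncard_le hunion_sub (by rw [hunion_card, hD'ncard]) D'.finite_toSet
  have hC3 : 3 ≤ C.ncard := by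
    have := hcirc C hC
    rw [← hCfin.cast_ncard_eq] at this
    exact_mod_cast this
  have hCle : C.ncard ≤ q + 1 := by omega
  refine ⟨(C, B'), ?_, ?_⟩
  · rw [Finset.mem_coe, Finset.mem_filter]
    refine ⟨?_, ?_, ?_⟩
    · unfold Matroid.pairsF
      rw [Finset.mem_filter]
      refine ⟨?_, hdisj, by show M.eRk (C ∪ B') ≤ q; rw [hunion]; exact hD'q.le⟩
      rw [Finset.mem_biUnion]
      refine ⟨C.ncard, by rw [Finset.mem_Icc]; omega, ?_⟩
      rw [Finset.mem_product]
      refine ⟨Matroid.mem_circF.2 ⟨hC, rfl⟩, ?_⟩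
      apply Matroid.mem_subsF_of
      · rw [Matroid.coe_groundF]; exact hB'D.trans hD'E
      · show B'.ncard = q + 1 - C.ncard
        omega
    · show C ∪ B' ⊆ (B : Set α)
      rw [hunion]; exact_mod_cast hD'B
    · show (B : Set α) ⊆ M.closure (C ∪ B')
      rw [hunion]; exact hBcl
  · exact hunion

open scoped Classical in
/-- **The level-`m` double count with the sharpened multiplicity**:
`((m − q) + 3·C(m − q, 2))·#levelF M q m ≤ Σ_{p ∈ pairsF M q} #fibreLevel M q p m`. -/
theorem mul_card_levelF_le_sum_quart [M.Finite] (q : ℕ) (hq : 1 ≤ q)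
    (hcirc : ∀ C, M.IsCircuit C → 3 ≤ C.encard) (hC1 : ∀ L ⊆ M.E, M.eRk L = 2 → L.ncard ≤ 3)
    (hC2 : ∀ L ⊆ M.E, M.eRk L ≤ 3 → L.ncard ≤ 6) (m : ℕ) :
    ((m - q) + 3 * (m - q).choose 2 + 3 * (m - q).choose 3 + 2 * (m - q).choose 4) * (Matroid.levelF M q m).card ≤
      ∑ p ∈ Matroid.pairsF M q, (Matroid.fibreLevel M q p m).card := by
  have hcomm : ∑ p ∈ Matroid.pairsF M q, (Matroid.fibreLevel M q p m).card =
      ∑ B ∈ Matroid.levelF M q m, ((Matroid.pairsF M q).filter (fun p => p.1 ∪ p.2 ⊆ (B : Set α) ∧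
        (B : Set α) ⊆ M.closure (p.1 ∪ p.2))).card := by
    unfold Matroid.fibreLevel
    simp only [Finset.card_filter]
    exact Finset.sum_comm
  rw [hcomm]
  calc ((m - q) + 3 * (m - q).choose 2 + 3 * (m - q).choose 3 + 2 * (m - q).choose 4) * (Matroid.levelF M q m).card =
        ∑ _B ∈ Matroid.levelF M q m, ((m - q) + 3 * (m - q).choose 2 + 3 * (m - q).choose 3 + 2 * (m - q).choose 4) := by
        simp [mul_comm]
    _ ≤ _ := by
      apply Finset.sum_le_sum
      intro B hB
      obtain ⟨hBg, hBm, hBq⟩ := Matroid.mem_levelF.1 hB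
      have hBE : (B : Set α) ⊆ M.E := by rw [← Matroid.coe_groundF]; exact_mod_cast hBg
      have := card_pairs_ge_quart q hq hcirc hC1 hC2 hBE hBq
      rw [hBm] at this
      exact this

open scoped Classical in
/-- **The level-`m` count with the giant split and the sharpened multiplicity.** -/
theorem mul_card_levelF_le_giant_quart [M.Finite] (q f f' ν₁ : ℕ) (hq : 1 ≤ q)
    (hcirc : ∀ C, M.IsCircuit C → 3 ≤ C.encard) (hC1 : ∀ L ⊆ M.E, M.eRk L = 2 → L.ncard ≤ 3)
    (hC2 : ∀ L ⊆ M.E, M.eRk L ≤ 3 → L.ncard ≤ 6)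
    (hflat : ∀ X ⊆ M.E, M.eRk X ≤ q → X.ncard ≤ f) {d : ℕ} (hd : M.E.encard = M.eRank + d) (m : ℕ) :
    ((m - q) + 3 * (m - q).choose 2 + 3 * (m - q).choose 3 + 2 * (m - q).choose 4) * (Matroid.levelF M q m).card ≤
      (Matroid.pairsSmall M q f').card * (f' - q).choose (m - (q + 1)) +
        (Matroid.pairsMid M q f' ν₁).card * (min (f - (q + 1)) (ν₁ - 2)).choose (m - (q + 1)) +
        (Matroid.pairsGiant M q f' ν₁).card * (min f (q + d) - (q + 1)).choose (m - (q + 1)) := by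
  have hsplit : ∑ p ∈ Matroid.pairsF M q, (Matroid.fibreLevel M q p m).card =
      ∑ p ∈ Matroid.pairsSmall M q f', (Matroid.fibreLevel M q p m).card +
        ∑ p ∈ Matroid.pairsBig M q f', (Matroid.fibreLevel M q p m).card := by
    unfold Matroid.pairsSmall Matroid.pairsBig
    exact (Finset.sum_filter_add_sum_filter_not (Matroid.pairsF M q) _ _).symm
  have hsplit2 : ∑ p ∈ Matroid.pairsBig M q f', (Matroid.fibreLevel M q p m).card =
      ∑ p ∈ Matroid.pairsGiant M q f' ν₁, (Matroid.fibreLevel M q p m).card +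
        ∑ p ∈ Matroid.pairsMid M q f' ν₁, (Matroid.fibreLevel M q p m).card := by
    unfold Matroid.pairsGiant Matroid.pairsMid
    exact (Finset.sum_filter_add_sum_filter_not (Matroid.pairsBig M q f') _ _).symm
  calc ((m - q) + 3 * (m - q).choose 2 + 3 * (m - q).choose 3 + 2 * (m - q).choose 4) * (Matroid.levelF M q m).card
      ≤ ∑ p ∈ Matroid.pairsF M q, (Matroid.fibreLevel M q p m).card :=
        mul_card_levelF_le_sum_quart q hq hcirc hC1 hC2 m
    _ = ∑ p ∈ Matroid.pairsSmall M q f', (Matroid.fibreLevel M q p m).card +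
          (∑ p ∈ Matroid.pairsGiant M q f' ν₁, (Matroid.fibreLevel M q p m).card +
            ∑ p ∈ Matroid.pairsMid M q f' ν₁, (Matroid.fibreLevel M q p m).card) := by rw [hsplit, hsplit2]
    _ ≤ ∑ _p ∈ Matroid.pairsSmall M q f', (f' - q).choose (m - (q + 1)) +
          (∑ _p ∈ Matroid.pairsGiant M q f' ν₁, (min f (q + d) - (q + 1)).choose (m - (q + 1)) +
            ∑ _p ∈ Matroid.pairsMid M q f' ν₁, (min (f - (q + 1)) (ν₁ - 2)).choose (m - (q + 1))) := by
        gcongr with p hp p hp p hp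
        · exact Matroid.card_fibreLevel_small q f' hp m
        · exact Matroid.card_fibreLevel_giant q f f' ν₁ hflat hd hp m
        · exact Matroid.card_fibreLevel_mid q f f' ν₁ hflat hp m
    _ = _ := by
        simp only [Finset.sum_const, smul_eq_mul]
        ring

end S2

end PercRepro
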